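import Summits.RiemannHypothesis.RiemannHypothesis.Theorems.PfPersistenceM2Thermometer
import HarnessLib

/-!
# PfPersistence (M2 seat, gen 2) — asymptotic M2 from three laws, with exponents

Bundle `papers/RiemannHypothesis/pf-persistence/` (cell `pub-rhpf`, seat M2), file `M2-ROUTE.md` §§2–4.
HONEST FRAMING: long-odds MECHANISM SEARCH; no RH claims.  Everything below is RH-free and
kernel-checked; the three "laws" are explicit HYPOTHESES (binders), nowhere asserted, and §3 proves
that the weakest of them (the floor) is already the Riemann hypothesis.

Scale of a window `[-a, a]`: `μ = e^{2a}`, law `L_B(a) = μ^B e^{-4πμ}` (Connes's law has `B ≈ 4.5–5.5`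
for the ground energy `ε₁ = ε(a) = weilGroundEnergy a`; DATA in M2-DATA.md).  The M2 ratio of a
normalised window test `p` (the mollified prolate guess) against a variational gap inequality of
constant `δ` in the direction of the ground state `u` is `(Re Q(p) − ε(a))/δ`, and the tree's
`GroundStatesConvergeToXi.one_sub_norm_sq_overlap_le_of_gap` (used through
`PfPersistenceM2.m2_of_floor_of_gapDominance`) turns a ratio bound into `1 − |⟨p,u⟩|² ≤ ratio`.

* §1 `exists_forall_ge_mul_rpow_neg_le`: `K μ^{-d} ≤ θ` on all large windows (`d > 0`).
* §2 `m2_asymptotic_of_three_laws`: HYPOTHESES, for all large `a`: (GAP) the gap inequality in the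
  direction of `u_a` with constant `δ_a ≥ c_G L_{B_G}(a)`, `c_G > 0`; (UPPER) a normalised window test
  `p_a` with `Re Q(p_a) ≤ C_U L_{B_U}(a)`; (FLOOR) `−σ L_{B_U}(a) ≤ ε(a)`; and `B_U < B_G`.  CONCLUSION:
  `1 − |⟨p_a, u_a⟩|² → 0`, quantitatively `≤ ((C_U + σ)/c_G) μ^{B_U − B_G}`: M2 along `a → ∞`.
  Which exponents: DATA (M2-DATA.md D1–D2) give `ε₂/ε₁ ≈ 10^{2.7} μ^{4.4}` and `R(k̂)/ε₁ ≈ 1.2–1.6`,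
  i.e. `B_G − B_U ≈ 4.4 > 0`; the prolate heuristic (Fuchs `1 − λ_n(c) ~ 4√π 8ⁿ c^{n+1/2} e^{-2c}/n!`,
  `c = 2πμ`, even indices `n = 4` vs `n = 8`) predicts `B_G − B_U = 4`.
* §3 `riemannHypothesis_of_lawFloor`: the FLOOR alone, `−σ μ^B e^{-4πμ} ≤ ε(a)` on all large
  windows (any real `σ, B`), implies the Riemann hypothesis (gen-1 thermometer
  `riemannHypothesis_of_groundEnergy_floor` + `μ^B e^{-4πμ} → 0`).  So of the three laws, (UPPER) is
  the provable half (in the tree up to the constant in the exponent for an explicit family: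
  `weilGroundEnergy_exp_exp_decay`, `SoloInformedGroundStateDecay2.lean`; with the sharp exponent
  `4π` it is `ConnesLawUpper`, reduced in `SoloInformedGroundStateZeroSide.lean` to a pointwise tail
  bound at the zeros), (GAP) is a quantitative second-eigenvalue statement about the prolate
  structure, and (FLOOR) is RH-strength — the thermometer, now with the exponent it must carry.

References: `ConnesConsaniMoscovici2025` (arXiv:2511.22755) §§7–8; `Connes2026Letter`
(arXiv:2602.04022) §§6–7; `ConnesSuijlekom2025` Thm 6.1; Fuchs 1964 (J. Math. Anal. Appl. 9, 317–330).
-/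

noncomputable section

set_option linter.dupNamespace false  -- the mandated namespace repeats `RiemannHypothesis`

open Set MeasureTheory Filter Complex
open scoped Real Topology ComplexConjugate

namespace Summit.RiemannHypothesis.RiemannHypothesis.Theorems.PfPersistenceM2Laws

open Literature.NumberTheory.LFunctions
open Summit.RiemannHypothesis.RiemannHypothesis.Theorems.PfPersistenceM2

/-! ## §1 Negative powers of `μ = e^{2a}` are eventually small -/

/-- `μ(a) = e^{2a} → ∞`. [folklore] -/
theorem tendsto_exp_two_mul_atTop : Tendsto (fun a : ℝ ↦ Real.exp (2 * a)) atTop atTop :=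
  Real.tendsto_exp_atTop.comp (tendsto_id.const_mul_atTop two_pos)

/-- For `d > 0`, `θ > 0` and any `K`: `K · μ^{-d} ≤ θ` on all large windows. [folklore] -/
theorem exists_forall_ge_mul_rpow_neg_le (K : ℝ) {d θ : ℝ} (hd : 0 < d) (hθ : 0 < θ) :
    ∃ a₁ : ℝ, ∀ a : ℝ, a₁ ≤ a → K * Real.exp (2 * a) ^ (-d) ≤ θ := by
  have h2 : Tendsto (fun a : ℝ ↦ K * Real.exp (2 * a) ^ (-d)) atTop (𝓝 (K * 0)) :=
    ((tendsto_rpow_neg_atTop hd).comp tendsto_exp_two_mul_atTop).const_mul K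
  rw [mul_zero] at h2
  obtain ⟨a₁, ha₁⟩ := eventually_atTop.1 (h2.eventually_lt_const hθ)
  exact ⟨a₁, fun a ha ↦ (ha₁ a ha).le⟩

/-! ## §2 Asymptotic M2 from the three laws -/

/-- **Asymptotic M2 from three laws.**  HYPOTHESES on all windows `a ≥ a₀`: (GAP) the variational gap
inequality in the direction of `u a` with constant `δ a`, and the gap LAW `c_G μ^{B_G} e^{-4πμ} ≤ δ a`
(`c_G > 0`); (UPPER) a normalised window test `p a` with `Re Q(p a) ≤ C_U μ^{B_U} e^{-4πμ}`; (FLOOR)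
`−σ μ^{B_U} e^{-4πμ} ≤ ε(a)`; exponents `B_U < B_G`.  CONCLUSION: for every `θ > 0`,
`1 − |⟨p a, u a⟩|² ≤ θ` on all large windows.  None of the three laws is asserted; §3 shows the
floor is RH-strength. [folklore] -/
theorem m2_asymptotic_of_three_laws {B_U B_G C_U c_G σ a₀ : ℝ} {u p : ℝ → ℝ → ℂ} {δ : ℝ → ℝ}
    (hgap : ∀ a : ℝ, a₀ ≤ a → ∀ f : ℝ → ℂ, IsWeilTest f → tsupport f ⊆ Icc (-a) a →
      δ a * ((∫ t, ‖f t‖ ^ 2) - ‖∫ t, f t * conj (u a t)‖ ^ 2) ≤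
        (weilQuadratic f).re - weilGroundEnergy a * ∫ t, ‖f t‖ ^ 2)
    (hG : ∀ a : ℝ, a₀ ≤ a →
      c_G * Real.exp (2 * a) ^ B_G * Real.exp (-(4 * π * Real.exp (2 * a))) ≤ δ a)
    (hcG : 0 < c_G)
    (hp : ∀ a : ℝ, a₀ ≤ a →
      IsWeilTest (p a) ∧ tsupport (p a) ⊆ Icc (-a) a ∧ ∫ t, ‖p a t‖ ^ 2 = (1 : ℝ))
    (hU : ∀ a : ℝ, a₀ ≤ a →
      (weilQuadratic (p a)).re ≤ C_U * Real.exp (2 * a) ^ B_U * Real.exp (-(4 * π * Real.exp (2 * a))))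
    (hfloor : ∀ a : ℝ, a₀ ≤ a →
      -(σ * Real.exp (2 * a) ^ B_U * Real.exp (-(4 * π * Real.exp (2 * a)))) ≤ weilGroundEnergy a)
    (hB : B_U < B_G) {θ : ℝ} (hθ : 0 < θ) :
    ∃ a₁ : ℝ, ∀ a : ℝ, a₁ ≤ a → 1 - ‖∫ t, p a t * conj (u a t)‖ ^ 2 ≤ θ := by
  obtain ⟨a₁, ha₁⟩ := exists_forall_ge_mul_rpow_neg_le ((C_U + σ) / c_G) (sub_pos.2 hB) hθ
  refine ⟨max a₀ a₁, fun a ha ↦ ?_⟩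
  have ha₀ : a₀ ≤ a := (le_max_left _ _).trans ha
  have hK := ha₁ a ((le_max_right _ _).trans ha)
  set μ : ℝ := Real.exp (2 * a) with hμ
  set L : ℝ := Real.exp (-(4 * π * Real.exp (2 * a))) with hL
  have hμpos : 0 < μ := Real.exp_pos _
  have hLpos : 0 < L := Real.exp_pos _
  obtain ⟨hpa, hps, hp1⟩ := hp a ha₀
  set X : ℝ := ‖∫ t, p a t * conj (u a t)‖ ^ 2 with hX
  -- the gap inequality at the normalised guess
  have h1 : δ a * (1 - X) ≤ (weilQuadratic (p a)).re - weilGroundEnergy a := by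
    have := hgap a ha₀ (p a) hpa hps
    rw [hp1, mul_one] at this
    exact this
  -- numerator: upper law + floor
  have h2 : (weilQuadratic (p a)).re - weilGroundEnergy a ≤ (C_U + σ) * μ ^ B_U * L := by
    have hu := hU a ha₀
    have hf := hfloor a ha₀
    rw [← hμ, ← hL] at hu hf
    nlinarith
  have hδ : c_G * μ ^ B_G * L ≤ δ a := by rw [hμ, hL]; exact hG a ha₀
  have hδpos : 0 < δ a := lt_of_lt_of_le (by positivity) hδ
  have h3 : 1 - X ≤ (C_U + σ) * μ ^ B_U * L / δ a := by
    rw [le_div_iff₀ hδpos, mul_comm]; exact h1.trans h2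
  -- compare with K μ^{-d}
  have hrpow : μ ^ B_U = μ ^ B_G * μ ^ (-(B_G - B_U)) := by
    rw [← Real.rpow_add hμpos]; ring_nf
  by_cases hN : (C_U + σ) ≤ 0
  · have : (C_U + σ) * μ ^ B_U * L / δ a ≤ 0 :=
      div_nonpos_of_nonpos_of_nonneg (mul_nonpos_of_nonpos_of_nonneg
        (mul_nonpos_of_nonpos_of_nonneg hN (Real.rpow_nonneg hμpos.le _)) hLpos.le) hδpos.le
    linarith
  · rw [not_le] at hN
    have h4 : (C_U + σ) * μ ^ B_U * L / δ a ≤ (C_U + σ) * μ ^ B_U * L / (c_G * μ ^ B_G * L) :=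
      div_le_div_of_nonneg_left (by positivity) (by positivity) hδ
    have h5 : (C_U + σ) * μ ^ B_U * L / (c_G * μ ^ B_G * L) =
        (C_U + σ) / c_G * μ ^ (-(B_G - B_U)) := by
      rw [hrpow]
      have hG' : μ ^ B_G ≠ 0 := (Real.rpow_pos_of_pos hμpos _).ne'
      field_simp
    linarith [h4.trans_eq h5]

/-! ## §3 The floor of the three laws is the Riemann hypothesis -/

/-- `μ^B e^{-4πμ} → 0` along the windows. [folklore] -/
theorem tendsto_law_nhds_zero (B : ℝ) :
    Tendsto (fun a : ℝ ↦ Real.exp (2 * a) ^ B * Real.exp (-(4 * π * Real.exp (2 * a)))) atTop (𝓝 0) := by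
  have h := (tendsto_rpow_mul_exp_neg_mul_atTop_nhds_zero B (4 * π) (by positivity)).comp
    tendsto_exp_two_mul_atTop
  refine h.congr' (Eventually.of_forall fun a ↦ ?_)
  simp only [Function.comp_apply, neg_mul]

/-- **The floor is RH-strength, with its exponent.**  If for some real `σ, B` and all windows
`a ≥ a₀` the ground energy obeys `−σ μ^B e^{-4πμ} ≤ ε(a)`, the Riemann hypothesis holds
(gen-1 thermometer `riemannHypothesis_of_groundEnergy_floor`: off RH, `ε(a) ≤ −η < 0` on all large
windows, while `σ μ^B e^{-4πμ} → 0`).  This is the (FLOOR) hypothesis of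
`m2_asymptotic_of_three_laws` with `B = B_U`. [folklore] -/
theorem riemannHypothesis_of_lawFloor {σ B a₀ : ℝ}
    (hfloor : ∀ a : ℝ, a₀ ≤ a →
      -(σ * Real.exp (2 * a) ^ B * Real.exp (-(4 * π * Real.exp (2 * a)))) ≤ weilGroundEnergy a) :
    RiemannHypothesis := by
  have ha : Tendsto (fun k : ℕ ↦ max a₀ 0 + k) atTop atTop :=
    tendsto_atTop_add_const_left _ _ tendsto_natCast_atTop_atTop
  refine riemannHypothesis_of_groundEnergy_floor (a := fun k : ℕ ↦ max a₀ 0 + k)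
    (σ := fun k : ℕ ↦ σ * (Real.exp (2 * (max a₀ 0 + k)) ^ B *
      Real.exp (-(4 * π * Real.exp (2 * (max a₀ 0 + k)))))) ha ?_
    (Eventually.of_forall fun k ↦ ?_)
  · simpa using ((tendsto_law_nhds_zero B).comp ha).const_mul σ
  · have hk : a₀ ≤ max a₀ 0 + k :=
      (le_max_left _ _).trans (le_add_of_nonneg_right (Nat.cast_nonneg k))
    simpa [mul_assoc] using hfloor _ hk

/-- **Corollary (the thermometer with exponents).**  Under (GAP) and (UPPER) of
`m2_asymptotic_of_three_laws`, the remaining input (FLOOR) cannot be supplied RH-free: it is itself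
the Riemann hypothesis. Recorded as the conjunction, for the bundle's §4. [folklore] -/
theorem m2_inputs_floor_is_RH {σ B_U a₀ : ℝ}
    (hfloor : ∀ a : ℝ, a₀ ≤ a →
      -(σ * Real.exp (2 * a) ^ B_U * Real.exp (-(4 * π * Real.exp (2 * a)))) ≤ weilGroundEnergy a) :
    RiemannHypothesis ∧ ∀ a : ℝ, a₀ ≤ a → -(σ * Real.exp (2 * a) ^ B_U *
      Real.exp (-(4 * π * Real.exp (2 * a)))) ≤ weilGroundEnergy a :=
  ⟨riemannHypothesis_of_lawFloor hfloor, hfloor⟩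

end Summit.RiemannHypothesis.RiemannHypothesis.Theorems.PfPersistenceM2Laws

end
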